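import Literature.MathematicalPhysics.PowerSystems.DVOCReducedConvergence
import HarnessLib

/-!
# dVOC networks WITH transmission-line dynamics: every non-collapsing solution of (15) converges to ONE
# synchronous steady state — a point of `𝒯` — with an exponential tail
# (Groß–Colombino–Brouillon–Dörfler 2019, Theorem 2 read with §II-C (6) and §V-B)

Topic `Literature/MathematicalPhysics/PowerSystems`, namespace
`Literature.MathematicalPhysics.PowerSystems.DvocLines` (the transmission-network record of
`DVOCLineDynamics.lean`; this file continues `DVOCLineConvergence.lean` and uses the amplitude-window
estimates of `DVOCReducedConvergence.lean` §12). THREE COLUMNS: MODELLED-column mathematics about the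
printed full-order model (15) (`N` dVOC-controlled converters as voltage sources, `M` dynamic RL lines
with uniform `ℓ/r` ratio = Assumption 1, consistent set-points traded for steady-state angles); no
declaration says that a converter, microgrid or grid is stable. 0 named facts: every theorem is PROVED.

Source (held, read on the page; `pNNNN` = PDF page of arXiv:1802.08881):
* [GrossEtAl2019] D. Groß, M. Colombino, J.-S. Brouillon, F. Dörfler, *The effect of transmission-line
  dynamics on grid-forming dispatchable virtual oscillator control*, IEEE TCNS 6 (2019) 1148–1160:
  **Theorem 2** p0005 L69–L78 («the dynamics (15) are almost globally asymptotically stable with respect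
  to 𝒯»); §II-C (6) p0003 L111–L116 («Synchronous frequency: … at steady state it holds that
  (d/dt)v_k = ω₀Jv_k … all voltages in the power network evolve as sinusoidal signals with frequency
  ω₀»); §IV-F Prop. 7 (33) and the proof of Theorem 2 p0007–p0008; §V-B p0009 («Condition 2 ensures
  exponential phase stability of the reduced-order system (17)»).

## What is proved, and what the print says

The print proves convergence to the SET `𝒯` (Thm. 2 via Thm. 1). This file PROVES, from the printed
ingredients only — Prop. 7's `ν̇ ≤ −m(ψ² + ‖y_o‖²) − d‖y_n‖²` along (15) (tree `prop7`,
`hasDerivWithinAt_nu`), Prop. 4's coercivity of `W` (tree `exists_coercive`), the (24)-type sandwich of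
`V` and the norm step `‖e_θ(v)‖ ≤ ‖𝒦 − 𝓛‖‖v‖_S` (tree `DvocReduced.psi_sq_ge`, `field_coord_sq_le`) —
that convergence to the set upgrades to convergence to a POINT of `𝒯`:
* `lineDecayRate`, `nuDot_le_neg_mul_nu` — on the amplitude window `{v_k*²/2 ≤ ‖v_k‖²}` the composite
  Lyapunov function (32) satisfies `ν̇ ≤ −μν` with the explicit
  `μ = min(2m/(dρ), 2/ρ, m·m_V/(1 − d))` (`m = mLB`, `d = dWeight`, `m_V = DvocReduced.decayMod`);
* `nu_le_mul_exp_neg` — hence `ν(x(t)) ≤ ν(x(T))e^{−μ(t−T)}` once the window holds from `T` on;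
* `exists_fullField_bound` — on the window `{‖v_k‖² ≤ 2v_k*²}` the velocity obeys `‖f(x)‖ ≤ K√ν(x)`
  for some `K ≥ 0` (sup norm; `f_v = f(v) − ηR(κ)ℬy` by (43), `f_i = −L_T⁻¹Z_T y` by (18), `W`'s
  coercivity `μ_c‖y‖² ≤ ‖y_o‖² + ‖y_n‖²`);
* `exists_forall_nearAmp`, `norm_sub_le_of_nearAmp`, `exists_tendsto_of_tendsto_infDist_target`,
  `norm_sub_lim_le` — every solution of (15) on `[0, ∞)` with `dist(x(t), 𝒯) → 0` eventually sits in
  the window, its displacement after time `s` is `≤ C e^{−(μ/2)(s−T)}`, it is Cauchy, and it converges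
  to some `x_∞ ∈ 𝒯` with that exponential tail;
* `thm2_exists_tendsto` — THEOREM 2, POINTWISE FORM, from the data alone: EVERY solution of (15) on
  `[0, ∞)` tends to `0ₙ` OR to ONE synchronous steady state `x_∞ = (S(a,b), i^s(S(a,b)))`,
  `a² + b² = 1` — all converters phase-locked at the prescribed relative angles with amplitudes `v_k*`,
  the lines at their quasi-steady-state currents, everything rotating at `ω₀` in the static frame
  (objective (6) verbatim); `exists_tendsto_of_nu_lt` — the same inside the region of attraction
  `{ν < ν(0ₙ)}`; `exists_tendsto_expTail'`, `thm2_exists_tendsto_expTail` — the same with the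
  exponential tail `‖x_∞ − x(s)‖ ≤ C e^{−(μ/2)(s−T)}` packaged (`∃ T C`, rate `μ = lineDecayRate`).
* `thm2_limit_objectives` (§7) / `DvocReduced.limit_objectives` (§8) — at the limit the control
  objectives (5)–(8) hold EXACTLY: `x_∞` is a rest point of the rotating-frame dynamics (`f(x_∞) = 0`,
  (6)), `v_∞ ∈ 𝒮` ((5)), `‖v_∞,k‖² = v_k*²` ((7)), `i_∞ = i^s(v_∞)`, and Definition 2's instantaneous
  powers equal the consistent set-points `p_k*`, `q_k*` ((8); tree `instP_of_InT`,
  `DvocReduced.instPqs_of_mem_target`).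
* `thm2_infDist_expDecay` (§9) / `DvocReduced.infDist_expDecay` — the SET-level statements with the
  explicit rate: `dist(x(s), 𝒯) ≤ C e^{−(μ/2)(s−T)}` for `s ≥ T` (resp. `dist(v(s), 𝒮 ∩ 𝒜)`, rate
  `α₁m/2`), or collapse.
* §0 (`DvocReduced.exists_tendsto_expTail`, `tendsto_zero_or_exists_tendsto_expTail`) packages the
  reduced-model (17) theorem of `DVOCReducedConvergence.lean` §12 the same way (`∃ v_∞ T C`, rate
  `α₁m/2`).
NOT typed: the measure-zero clause of «almost globally»; the print's spectral «exponentially unstable»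
for `0ₙ`. MODELLED: model (15); nothing here is a grid.
-/

noncomputable section

namespace Literature.MathematicalPhysics.PowerSystems

open Real Finset Set Filter Metric
open scoped _root_.Topology
open Literature.Analysis.ODE

namespace DvocReduced

/-! ## §0 Reduced model (17): the point-convergence theorem with its exponential tail packaged -/

variable {N : ℕ} (W : DvocReduced N)

/-- **Reduced model (17): convergence to ONE point of `𝒮 ∩ 𝒜` with an explicit exponential tail,
packaged** — for every solution on `[0, ∞)` approaching `𝒮 ∩ 𝒜` there are `v_∞ ∈ 𝒮 ∩ 𝒜`, a time
`T` and `C ≥ 0` with `v(t) → v_∞` and `‖v_∞ − v(s)‖ ≤ C e^{−(α₁m/2)(s−T)}` for all `s ≥ T`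
(`m = decayMod`; the tree's `exists_tendsto_of_tendsto_infDist_target` + `norm_sub_lim_le`).
[cite: GrossEtAl2019, Prop. 3 / Thm. 2 with §II-C (6); §V-B] MODELLED: reduced model (17). -/
theorem exists_tendsto_expTail [NeZero N] (hη : 0 < W.η) (hα : 0 < W.α)
    (hv : ∀ k, 0 < W.vref k) {c κ₀ : ℝ} (hc : 0 < c) (hκ₀ : 0 < κ₀) (h23 : W.DecreaseOnS c)
    (hK : W.PhaseErrorBound κ₀) {γ : ℝ → DvocState N} (hsol : W.IsSolutionOn γ (Ici 0))
    (hT : Tendsto (fun t => infDist (γ t) W.target) atTop (𝓝 0)) :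
    ∃ v, v ∈ W.target ∧ Tendsto γ atTop (𝓝 v) ∧ ∃ T C : ℝ, 0 ≤ C ∧ ∀ s, T ≤ s →
      ‖v - γ s‖ ≤ C * Real.exp (-(W.alpha1 c κ₀ * W.decayMod c κ₀ / 2) * (s - T)) := by
  have hne : ∀ k, W.vref k ≠ 0 := fun k => (hv k).ne'
  obtain ⟨v, hvT, hlim⟩ := W.exists_tendsto_of_tendsto_infDist_target hη hα hv hc hκ₀ h23 hK hsol hT
  obtain ⟨T, hT0, hR⟩ := W.exists_forall_nearAmp hne hT
  have hKf := W.fieldBoundConst_nonneg hη.le c κ₀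
  have hα₁ : 0 < W.alpha1 c κ₀ := by unfold DvocReduced.alpha1; positivity
  have hm := W.decayMod_pos hη hα hc hκ₀
  exact ⟨v, hvT, hlim, T,
    2 * W.fieldBoundConst c κ₀ * Real.sqrt (W.V (W.alpha1 c κ₀) (γ T)) / (W.alpha1 c κ₀ * W.decayMod c κ₀),
    by positivity, fun s hs => W.norm_sub_lim_le hη hα hv hc hκ₀ h23 hK hsol hT0 hR hlim hs⟩

/-- **Reduced model (17), from the data alone**: every solution on `[0, ∞)` tends to `0` or converges
to ONE point `v_∞ ∈ 𝒮 ∩ 𝒜` with an exponential tail `‖v_∞ − v(s)‖ ≤ C e^{−(α₁m/2)(s−T)}` (`s ≥ T`).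
[cite: GrossEtAl2019, Prop. 3 / Thm. 2 with §II-C (6); §V-B] MODELLED: reduced model (17); the rate
constant is the kernel's; nothing here is a grid. -/
theorem tendsto_zero_or_exists_tendsto_expTail [NeZero N] (hη : 0 < W.η) (hα : 0 < W.α)
    (hv : ∀ k, 0 < W.vref k) {c κ₀ : ℝ} (hc : 0 < c) (hκ₀ : 0 < κ₀) (h23 : W.DecreaseOnS c)
    (hK : W.PhaseErrorBound κ₀) {γ : ℝ → DvocState N} (hsol : W.IsSolutionOn γ (Ici 0)) :
    Tendsto γ atTop (𝓝 0) ∨ ∃ v, v ∈ W.target ∧ Tendsto γ atTop (𝓝 v) ∧ ∃ T C : ℝ, 0 ≤ C ∧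
      ∀ s, T ≤ s → ‖v - γ s‖ ≤ C * Real.exp (-(W.alpha1 c κ₀ * W.decayMod c κ₀ / 2) * (s - T)) := by
  rcases W.tendsto_infDist_target_or_tendsto_zero hη hα hv hc hκ₀ h23 hK hsol with hT | h0
  · exact Or.inr (W.exists_tendsto_expTail hη hα hv hc hκ₀ h23 hK hsol hT)
  · exact Or.inl h0

end DvocReduced

namespace DvocLines

variable {N M : ℕ} (E : DvocLines N M) (W : DvocReduced N)

section pointConvergence

variable {M₀ : ℕ} (C : Fin M₀ → Fin M → ℝ)

/-! ## §1 The decay rate of `ν` on the amplitude window -/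

/-- The decay rate `μ := min(2m/(dρ), 2/ρ, m·m_V/(1 − d))` of `ν̇ ≤ −μν` on the inner amplitude window
(`m = mLB`, `d = dWeight` of Prop. 7; `m_V = DvocReduced.decayMod` of `ψ² ≥ m_V V`).
[cite: GrossEtAl2019, Prop. 7 (33) with Prop. 3 (25)] -/
def lineDecayRate (c κ₀ Υ : ℝ) : ℝ :=
  min (min (2 * E.mLB W c κ₀ Υ / (E.dWeight κ₀ Υ * E.ρ)) (2 / E.ρ))
    (E.mLB W c κ₀ Υ * W.decayMod c κ₀ / (1 - E.dWeight κ₀ Υ))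

/-- `μ > 0` under the hypotheses of Prop. 7 ((35), `ρ, η, α, c, κ₀, Υ > 0`). [cite: GrossEtAl2019,
Prop. 7] -/
theorem lineDecayRate_pos (hρ : 0 < E.ρ) (hη : 0 < W.η) (hα : 0 < W.α) {c κ₀ Υ : ℝ} (hc : 0 < c)
    (hκ₀ : 0 < κ₀) (hΥ : 0 < Υ) (h35 : W.η < c / (E.ρ * Υ * (c + 5 * κ₀))) :
    0 < E.lineDecayRate W c κ₀ Υ := by
  obtain ⟨hd0, hd1⟩ := E.dWeight_mem_Ioo hρ hκ₀ hΥ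
  obtain ⟨-, hm⟩ := E.prop7_constants_pos W hρ hη hc hκ₀ hΥ h35
  have hmV := W.decayMod_pos hη hα hc hκ₀
  have h1d : 0 < 1 - E.dWeight κ₀ Υ := by linarith
  unfold lineDecayRate
  exact lt_min (lt_min (by positivity) (by positivity)) (by positivity)

/-- **`ν̇ ≤ −μν` on the inner amplitude window** `{‖v_k‖² ≥ v_k*²/2 ∀k}`: Prop. 7's
`ν̇ ≤ −m(ψ² + ‖y_o‖²) − d‖y_n‖²` with `ψ² ≥ m_V V` and `ν = d(ρ/2)(‖y_o‖² + ‖y_n‖²) + (1 − d)V`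
(hypotheses of the tree's `prop7`). [cite: GrossEtAl2019, Prop. 7 (33), Prop. 3 (25)] MODELLED: model (15). -/
theorem nuDot_le_neg_mul_nu [NeZero N] (h : E.Consistent W) (hρ : 0 < E.ρ) (hη : 0 < W.η)
    (hα : 0 < W.α) (hv : ∀ k, 0 < W.vref k) {c κ₀ Υ : ℝ} (hc : 0 < c) (hκ₀ : 0 < κ₀) (hcκ : c ≤ κ₀)
    (hΥ : 0 < Υ) (h23 : W.DecreaseOnS c) (hK : W.PhaseErrorBound κ₀) (hY : E.AdmittanceBound Υ)
    (h35 : W.η < c / (E.ρ * Υ * (c + 5 * κ₀))) {x : DvocState N × LineState M}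
    (hR : ∀ k, W.vref k ^ 2 / 2 ≤ dvocNsq x.1 k) :
    E.nuDot W C (E.dWeight κ₀ Υ) (W.alpha1 c κ₀) x
      ≤ -(E.lineDecayRate W c κ₀ Υ) * E.nu W C (E.dWeight κ₀ Υ) (W.alpha1 c κ₀) x := by
  set d := E.dWeight κ₀ Υ with hddef
  set m := E.mLB W c κ₀ Υ with hmdef
  set mV := W.decayMod c κ₀ with hmVdef
  set μ := E.lineDecayRate W c κ₀ Υ with hμdef
  set α₁ := W.alpha1 c κ₀ with hα₁def
  set y := E.dev x.1 x.2 with hy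
  set Yo := E.normYoSq y with hYo
  set Yn := E.normYnSq C y with hYn
  set Vv := W.V α₁ x.1 with hVv
  have hΛ : W.Lam ≠ 0 := (W.Lam_pos hv).ne'
  have hne : ∀ k, W.vref k ≠ 0 := fun k => (hv k).ne'
  obtain ⟨hd0, hd1⟩ := E.dWeight_mem_Ioo hρ hκ₀ hΥ
  obtain ⟨-, hm⟩ := E.prop7_constants_pos W hρ hη hc hκ₀ hΥ h35
  have hα₁ : 0 < α₁ := by rw [hα₁def]; unfold DvocReduced.alpha1; positivity
  have h1d : 0 < 1 - d := by rw [hddef]; linarith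
  have hYo0 : 0 ≤ Yo := E.normYoSq_nonneg y
  have hYn0 : 0 ≤ Yn := E.normYnSq_nonneg C y
  have hVv0 : 0 ≤ Vv := W.V_nonneg hΛ (by positivity) x.1
  have h7 := E.prop7 W h (C := C) hρ hη hα.le hv hc hκ₀ hcκ hΥ h23 hK hY h35 x
  have hψ : mV * Vv ≤ W.psi κ₀ x.1 ^ 2 := W.psi_sq_ge hη.le hα.le hκ₀.le hα₁ hΛ hne hR
  -- the three rate comparisons
  have hμ1 : μ ≤ 2 * m / (d * E.ρ) := (min_le_left _ _).trans (min_le_left _ _)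
  have hμ2 : μ ≤ 2 / E.ρ := (min_le_left _ _).trans (min_le_right _ _)
  have hμ3 : μ ≤ m * mV / (1 - d) := min_le_right _ _
  have hμ1' : μ * (d * E.ρ) ≤ 2 * m := (le_div_iff₀ (by positivity)).1 hμ1
  have hμ2' : μ * E.ρ ≤ 2 := (le_div_iff₀ hρ).1 hμ2
  have hμ3' : μ * (1 - d) ≤ m * mV := (le_div_iff₀ h1d).1 hμ3
  have hd0' : 0 < d := hd0
  have hm' : 0 < m := hm
  have t1 : μ * (d * (E.ρ / 2) * Yo) ≤ m * Yo := by
    have := mul_le_mul_of_nonneg_right hμ1' hYo0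
    nlinarith
  have t2 : μ * (d * (E.ρ / 2) * Yn) ≤ d * Yn := by
    have hdYn : 0 ≤ d * Yn := mul_nonneg hd0'.le hYn0
    have := mul_le_mul_of_nonneg_right hμ2' hdYn
    nlinarith
  have t3 : μ * ((1 - d) * Vv) ≤ m * W.psi κ₀ x.1 ^ 2 := by
    have h1 := mul_le_mul_of_nonneg_right hμ3' hVv0
    have h2 := mul_le_mul_of_nonneg_left hψ hm'.le
    nlinarith
  have hnu : E.nu W C d α₁ x = d * (E.ρ / 2) * Yo + d * (E.ρ / 2) * Yn + (1 - d) * Vv := by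
    simp only [nu, Wfun, ← hy, ← hYo, ← hYn, ← hVv]; ring
  rw [hnu]
  have : μ * (d * (E.ρ / 2) * Yo + d * (E.ρ / 2) * Yn + (1 - d) * Vv)
      ≤ m * (W.psi κ₀ x.1 ^ 2 + Yo) + d * Yn := by nlinarith
  linarith

/-! ## §2 Exponential decay of `ν` once the amplitudes are in the window -/

/-- **`ν(x(t)) ≤ ν(x(T)) e^{−μ(t−T)}`** along a solution of (15) on `[0, ∞)` whose amplitudes satisfy
`‖v_k(τ)‖² ≥ v_k*²/2` for all `τ ≥ T ≥ 0` (`t ≥ T`; hypotheses of the tree's `prop7`).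
[cite: GrossEtAl2019, Prop. 7 / proof of Thm. 2; §V-B («exponential phase stability»)] MODELLED: model (15). -/
theorem nu_le_mul_exp_neg [NeZero N] (h : E.Consistent W) (hC : E.IsCycle C) (hρ : 0 < E.ρ)
    (ha : ∀ l, 0 < E.a l) (hη : 0 < W.η) (hα : 0 < W.α) (hv : ∀ k, 0 < W.vref k) {c κ₀ Υ : ℝ}
    (hc : 0 < c) (hκ₀ : 0 < κ₀) (hcκ : c ≤ κ₀) (hΥ : 0 < Υ) (h23 : W.DecreaseOnS c)
    (hK : W.PhaseErrorBound κ₀) (hY : E.AdmittanceBound Υ) (h35 : W.η < c / (E.ρ * Υ * (c + 5 * κ₀)))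
    {γ : ℝ → DvocState N × LineState M} (hsol : E.IsSolutionOn W γ (Ici 0)) {T : ℝ} (hT0 : 0 ≤ T)
    (hR : ∀ τ, T ≤ τ → ∀ k, W.vref k ^ 2 / 2 ≤ dvocNsq (γ τ).1 k) {t : ℝ} (ht : T ≤ t) :
    E.nu W C (E.dWeight κ₀ Υ) (W.alpha1 c κ₀) (γ t)
      ≤ E.nu W C (E.dWeight κ₀ Υ) (W.alpha1 c κ₀) (γ T)
          * Real.exp (-(E.lineDecayRate W c κ₀ Υ) * (t - T)) := by
  set d := E.dWeight κ₀ Υ with hddef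
  set α₁ := W.alpha1 c κ₀ with hα₁def
  set μ := E.lineDecayRate W c κ₀ Υ with hμdef
  have ha' : ∀ l, E.a l ≠ 0 := fun l => (ha l).ne'
  -- `g(τ) := e^{μτ} ν(γ τ)` is antitone on `[T, t]`
  have hd : ∀ τ ∈ Icc T t, HasDerivWithinAt (fun σ => Real.exp (μ * σ) * E.nu W C d α₁ (γ σ))
      (Real.exp (μ * τ) * (μ * 1) * E.nu W C d α₁ (γ τ)
        + Real.exp (μ * τ) * E.nuDot W C d α₁ (γ τ)) (Icc T t) τ := by
    intro τ hτ
    have hγ : HasDerivWithinAt γ (E.fullField W (γ τ)) (Icc T t) τ :=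
      (hsol τ (show τ ∈ Ici (0 : ℝ) from hT0.trans hτ.1)).mono fun σ hσ => hT0.trans hσ.1
    have he : HasDerivWithinAt (fun σ => Real.exp (μ * σ)) (Real.exp (μ * τ) * (μ * 1)) (Icc T t) τ :=
      (((hasDerivAt_id τ).const_mul μ).exp).hasDerivWithinAt
    exact he.mul (E.hasDerivWithinAt_nu W C h hρ.ne' ha' hC d α₁ hγ)
  have hanti : AntitoneOn (fun σ => Real.exp (μ * σ) * E.nu W C d α₁ (γ σ)) (Icc T t) := by
    refine antitoneOn_of_hasDerivWithinAt_nonpos (convex_Icc T t)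
      (fun τ hτ => (hd τ hτ).continuousWithinAt)
      (fun τ hτ => (hd τ (interior_subset hτ)).mono interior_subset) (fun τ hτ => ?_)
    have hτT : T ≤ τ := (interior_subset (s := Icc T t) hτ).1
    have hle := E.nuDot_le_neg_mul_nu W C h hρ hη hα hv hc hκ₀ hcκ hΥ h23 hK hY h35 (hR τ hτT)
    have he0 : 0 < Real.exp (μ * τ) := Real.exp_pos _
    have key : Real.exp (μ * τ) * (μ * 1) * E.nu W C d α₁ (γ τ) + Real.exp (μ * τ) * E.nuDot W C d α₁ (γ τ)
        = Real.exp (μ * τ) * (μ * E.nu W C d α₁ (γ τ) + E.nuDot W C d α₁ (γ τ)) := by ring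
    rw [key]
    refine mul_nonpos_iff.2 (Or.inl ⟨he0.le, ?_⟩)
    rw [← hddef, ← hα₁def, ← hμdef] at hle
    linarith
  have hmono := hanti (left_mem_Icc.2 ht) (right_mem_Icc.2 ht) ht
  have he0 : 0 < Real.exp (-(μ * t)) := Real.exp_pos _
  have hprod : Real.exp (-(μ * t)) * Real.exp (μ * t) = 1 := by
    rw [← Real.exp_add, neg_add_cancel, Real.exp_zero]
  calc E.nu W C d α₁ (γ t) = Real.exp (-(μ * t)) * (Real.exp (μ * t) * E.nu W C d α₁ (γ t)) := by
        rw [← mul_assoc, hprod, one_mul]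
    _ ≤ Real.exp (-(μ * t)) * (Real.exp (μ * T) * E.nu W C d α₁ (γ T)) :=
        mul_le_mul_of_nonneg_left hmono he0.le
    _ = E.nu W C d α₁ (γ T) * Real.exp (-μ * (t - T)) := by
        rw [← mul_assoc, ← Real.exp_add]
        ring_nf

/-! ## §3 The velocity bound `‖f(x)‖ ≤ K√ν(x)` on the outer amplitude window -/

/-- Two-dimensional Cauchy–Schwarz: `(pa + qb)² ≤ (p² + q²)(a² + b²)`. [folklore] -/
private theorem cs_sq_le (p q a b : ℝ) : (p * a + q * b) ^ 2 ≤ (p ^ 2 + q ^ 2) * (a ^ 2 + b ^ 2) := by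
  nlinarith [sq_nonneg (p * b - q * a)]

/-- `(c a − s b)² ≤ a² + b²` and `(s a + c b)² ≤ a² + b²` for `c² + s² = 1` (a rotated coordinate is
bounded by the norm). [folklore] -/
private theorem rot_coord_sq_le {c s : ℝ} (hcs : c ^ 2 + s ^ 2 = 1) (a b : ℝ) :
    (c * a - s * b) ^ 2 ≤ a ^ 2 + b ^ 2 ∧ (s * a + c * b) ^ 2 ≤ a ^ 2 + b ^ 2 := by
  constructor
  · have h := cs_sq_le c (-s) a b
    have e1 : c * a + -s * b = c * a - s * b := by ring
    have e2 : c ^ 2 + (-s) ^ 2 = 1 := by rw [neg_sq]; exact hcs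
    rw [e1, e2, one_mul] at h
    exact h
  · have h := cs_sq_le s c a b
    have e2 : s ^ 2 + c ^ 2 = 1 := by rw [add_comm]; exact hcs
    rw [e2, one_mul] at h
    exact h

/-- **Velocity bound on the outer amplitude window** `{‖v_k‖² ≤ 2v_k*² ∀k}`: there is `K ≥ 0` with
`‖f(x)‖ ≤ K√ν(x)` there (sup norm of the tree's state space). Ingredients: `f_v = f(v) − ηR(κ)ℬy`
((43)) with `‖ηg_k‖² ≤ K_f²V` (tree `DvocReduced.field_coord_sq_le`) and `‖(ℬy)_k‖² ≤ ‖y_o‖²`;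
`f_i = −L_T⁻¹Z_T y` ((18)) with `μ_c‖y‖² ≤ ‖y_o‖² + ‖y_n‖²` (Prop. 4, tree `exists_coercive`); and
`(1 − d)V ≤ ν`, `(dρ/2)(‖y_o‖² + ‖y_n‖²) ≤ ν`. Requires the rows of `C` to span `ker B`, `ρ > 0`,
`‖Y_l‖ > 0`, `η, α > 0`, `v_k* > 0`, `c, κ₀, Υ > 0`, `PhaseErrorBound κ₀`, `Consistent`.
[cite: GrossEtAl2019, eq. (15), (18), (43), (31)–(32), Prop. 4] MODELLED: model (15). -/
theorem exists_fullField_bound [NeZero N] (h : E.Consistent W) (hspan : E.SpansCycles C)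
    (hρ : 0 < E.ρ) (ha : ∀ l, 0 < E.a l) (hη : 0 < W.η) (hα : 0 < W.α) (hv : ∀ k, 0 < W.vref k)
    {c κ₀ Υ : ℝ} (hc : 0 < c) (hκ₀ : 0 < κ₀) (hΥ : 0 < Υ) (hK : W.PhaseErrorBound κ₀) :
    ∃ K : ℝ, 0 ≤ K ∧ ∀ x : DvocState N × LineState M, (∀ k, dvocNsq x.1 k ≤ 2 * W.vref k ^ 2) →
      ‖E.fullField W x‖ ≤ K * Real.sqrt (E.nu W C (E.dWeight κ₀ Υ) (W.alpha1 c κ₀) x) := by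
  set d := E.dWeight κ₀ Υ with hddef
  set α₁ := W.alpha1 c κ₀ with hα₁def
  set Kf := W.fieldBoundConst c κ₀ with hKfdef
  have hΛ : W.Lam ≠ 0 := (W.Lam_pos hv).ne'
  have hne : ∀ k, W.vref k ≠ 0 := fun k => (hv k).ne'
  have ha' : ∀ l, E.a l ≠ 0 := fun l => (ha l).ne'
  obtain ⟨hd0, hd1⟩ := E.dWeight_mem_Ioo hρ hκ₀ hΥ
  have hd0' : 0 < d := hd0
  have h1d : 0 < 1 - d := by rw [hddef]; linarith
  have hα₁ : 0 < α₁ := by rw [hα₁def]; unfold DvocReduced.alpha1; positivity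
  have hw : 0 < W.η * W.α * α₁ := by positivity
  have hinj := E.dev_injective_of_spansCycles C hspan fun l => E.ind_pos hρ (ha l)
  obtain ⟨μc, hμc, hcoer⟩ := E.exists_coercive C hρ hinj
  -- the two coordinate constants
  set A₁ : ℝ := 2 * Kf ^ 2 / (1 - d) + 4 * W.η ^ 2 / (E.ρ * d) with hA₁
  set A₂ : ℝ := ((1 / E.ρ) ^ 2 + E.ω₀ ^ 2) * (4 / (E.ρ * d * μc)) with hA₂
  have hA₁0 : 0 ≤ A₁ := by positivity
  have hA₂0 : 0 ≤ A₂ := by positivity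
  refine ⟨Real.sqrt (A₁ + A₂), Real.sqrt_nonneg _, fun x hRx => ?_⟩
  set y := E.dev x.1 x.2 with hy
  set Yo := E.normYoSq y with hYo
  set Yn := E.normYnSq C y with hYn
  set Vv := W.V α₁ x.1 with hVv
  set nuv := E.nu W C d α₁ x with hnuv
  have hYo0 : 0 ≤ Yo := E.normYoSq_nonneg y
  have hYn0 : 0 ≤ Yn := E.normYnSq_nonneg C y
  have hVv0 : 0 ≤ Vv := W.V_nonneg hΛ hw.le x.1
  have hnu : nuv = d * (E.ρ / 2) * (Yo + Yn) + (1 - d) * Vv := by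
    simp only [hnuv, nu, Wfun, ← hy, ← hYo, ← hYn, ← hVv]; ring
  have hnu0 : 0 ≤ nuv := by rw [hnu]; positivity
  -- `V ≤ ν/(1−d)`, `Yo + Yn ≤ 2ν/(ρd)`, `‖y‖² ≤ (Yo + Yn)/μc`
  have hVle : Vv ≤ nuv / (1 - d) := by
    rw [le_div_iff₀ h1d, hnu]
    have : 0 ≤ d * (E.ρ / 2) * (Yo + Yn) := by positivity
    linarith
  have hYle : Yo + Yn ≤ 2 * nuv / (E.ρ * d) := by
    rw [le_div_iff₀ (by positivity), hnu]
    have : 0 ≤ (1 - d) * Vv := mul_nonneg h1d.le hVv0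
    have e : 2 * (d * (E.ρ / 2) * (Yo + Yn) + (1 - d) * Vv)
        = (Yo + Yn) * (E.ρ * d) + 2 * ((1 - d) * Vv) := by ring
    linarith
  have hyle : ‖y‖ ^ 2 ≤ (Yo + Yn) / μc := by
    rw [le_div_iff₀ hμc]; have := hcoer y; rw [← hYo, ← hYn] at this; linarith
  have hysq : ‖y‖ ^ 2 ≤ 2 * nuv / (E.ρ * d * μc) := by
    calc ‖y‖ ^ 2 ≤ (Yo + Yn) / μc := hyle
      _ ≤ (2 * nuv / (E.ρ * d)) / μc := by gcongr
      _ = 2 * nuv / (E.ρ * d * μc) := by rw [div_div]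
  -- coordinate bounds, voltage part
  have hcs := E.cκ_sq_add_sκ_sq
  have hnode : ∀ k, E.nodeCur₁ y k ^ 2 + E.nodeCur₂ y k ^ 2 ≤ Yo := fun k => by
    have : E.nodeCur₁ y k ^ 2 + E.nodeCur₂ y k ^ 2 = dvocNsq (E.nodeCur y) k := by
      simp [dvocNsq, nodeCur]
    rw [this, hYo]
    unfold normYoSq
    exact Finset.single_le_sum (f := fun j => dvocNsq (E.nodeCur y) j)
      (fun j _ => by unfold dvocNsq; positivity) (Finset.mem_univ k)
  have hKfV : Kf ^ 2 * Vv ≤ Kf ^ 2 * (nuv / (1 - d)) := mul_le_mul_of_nonneg_left hVle (sq_nonneg _)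
  have hYo' : Yo ≤ 2 * nuv / (E.ρ * d) := by linarith
  have hbound : 2 * (Kf ^ 2 * (nuv / (1 - d))) + 2 * (W.η ^ 2 * (2 * nuv / (E.ρ * d))) = A₁ * nuv := by
    rw [hA₁]; ring
  have hA₁nn : 0 ≤ A₁ * nuv := mul_nonneg hA₁0 hnu0
  have hA₂nn : 0 ≤ A₂ * nuv := mul_nonneg hA₂0 hnu0
  have hη2 : 0 ≤ W.η ^ 2 := sq_nonneg _
  have two_sq : ∀ a b : ℝ, (a - W.η * b) ^ 2 ≤ 2 * a ^ 2 + 2 * (W.η ^ 2 * b ^ 2) := fun a b => by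
    nlinarith [sq_nonneg (a + W.η * b)]
  have hv_coord : ∀ k, E.fv₁ W x.1 x.2 k ^ 2 ≤ (A₁ + A₂) * nuv ∧
      E.fv₂ W x.1 x.2 k ^ 2 ≤ (A₁ + A₂) * nuv := by
    intro k
    obtain ⟨hg1, hg2⟩ := W.field_coord_sq_le hη hα hα₁ hΛ hne hK hRx k
    obtain ⟨hr1, hr2⟩ := rot_coord_sq_le hcs (E.nodeCur₁ y k) (E.nodeCur₂ y k)
    have hnk := hnode k
    have e1 := E.fv₁_eq W h x.1 x.2 k
    have e2 := E.fv₂_eq W h x.1 x.2 k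
    rw [← hy] at e1 e2
    rw [← hKfdef, ← hα₁def, ← hVv] at hg1 hg2
    constructor
    · rw [e1]
      have h1 := two_sq (W.η * W.g₁ x.1 k) (E.cκ * E.nodeCur₁ y k - E.sκ * E.nodeCur₂ y k)
      have h2 : W.η ^ 2 * (E.cκ * E.nodeCur₁ y k - E.sκ * E.nodeCur₂ y k) ^ 2
          ≤ W.η ^ 2 * (2 * nuv / (E.ρ * d)) :=
        mul_le_mul_of_nonneg_left (hr1.trans (hnk.trans hYo')) hη2
      linarith
    · rw [e2]
      have h1 := two_sq (W.η * W.g₂ x.1 k) (E.sκ * E.nodeCur₁ y k + E.cκ * E.nodeCur₂ y k)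
      have h2 : W.η ^ 2 * (E.sκ * E.nodeCur₁ y k + E.cκ * E.nodeCur₂ y k) ^ 2
          ≤ W.η ^ 2 * (2 * nuv / (E.ρ * d)) :=
        mul_le_mul_of_nonneg_left (hr2.trans (hnk.trans hYo')) hη2
      linarith
  -- coordinate bounds, current part
  have hq0 : 0 ≤ (1 / E.ρ) ^ 2 + E.ω₀ ^ 2 := by positivity
  have hi_coord : ∀ l, E.fi₁ x.1 x.2 l ^ 2 ≤ (A₁ + A₂) * nuv ∧
      E.fi₂ x.1 x.2 l ^ 2 ≤ (A₁ + A₂) * nuv := by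
    intro l
    have e1 := E.fi₁_eq_bl₁ hρ.ne' x.1 x.2 (ha' l)
    have e2 := E.fi₂_eq_bl₂ hρ.ne' x.1 x.2 (ha' l)
    rw [← hy] at e1 e2
    have hy1 : (y.1 l) ^ 2 ≤ ‖y‖ ^ 2 := by
      have h1 : ‖y.1 l‖ ≤ ‖y‖ := (norm_le_pi_norm y.1 l).trans (norm_fst_le y)
      rw [Real.norm_eq_abs] at h1
      have := abs_nonneg (y.1 l)
      calc (y.1 l) ^ 2 = |y.1 l| ^ 2 := (sq_abs _).symm
        _ ≤ ‖y‖ ^ 2 := pow_le_pow_left₀ this h1 2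
    have hy2 : (y.2 l) ^ 2 ≤ ‖y‖ ^ 2 := by
      have h1 : ‖y.2 l‖ ≤ ‖y‖ := (norm_le_pi_norm y.2 l).trans (norm_snd_le y)
      rw [Real.norm_eq_abs] at h1
      have := abs_nonneg (y.2 l)
      calc (y.2 l) ^ 2 = |y.2 l| ^ 2 := (sq_abs _).symm
        _ ≤ ‖y‖ ^ 2 := pow_le_pow_left₀ this h1 2
    have hsum2 : (y.1 l) ^ 2 + (y.2 l) ^ 2 ≤ 4 * nuv / (E.ρ * d * μc) := by
      have e : 4 * nuv / (E.ρ * d * μc) = 2 * (2 * nuv / (E.ρ * d * μc)) := by ring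
      rw [e]; linarith
    have hb1 := cs_sq_le (-(1 / E.ρ)) E.ω₀ (y.1 l) (y.2 l)
    have hb2 := cs_sq_le (-(1 / E.ρ)) (-E.ω₀) (y.2 l) (y.1 l)
    have ep : (-(1 / E.ρ)) ^ 2 + E.ω₀ ^ 2 = (1 / E.ρ) ^ 2 + E.ω₀ ^ 2 := by rw [neg_sq]
    have ep' : (-(1 / E.ρ)) ^ 2 + (-E.ω₀) ^ 2 = (1 / E.ρ) ^ 2 + E.ω₀ ^ 2 := by rw [neg_sq, neg_sq]
    rw [ep] at hb1
    rw [ep'] at hb2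
    have hc1 : ((1 / E.ρ) ^ 2 + E.ω₀ ^ 2) * ((y.1 l) ^ 2 + (y.2 l) ^ 2) ≤ A₂ * nuv := by
      calc ((1 / E.ρ) ^ 2 + E.ω₀ ^ 2) * ((y.1 l) ^ 2 + (y.2 l) ^ 2)
          ≤ ((1 / E.ρ) ^ 2 + E.ω₀ ^ 2) * (4 * nuv / (E.ρ * d * μc)) :=
            mul_le_mul_of_nonneg_left hsum2 hq0
        _ = A₂ * nuv := by rw [hA₂]; ring
    have hc2 : ((1 / E.ρ) ^ 2 + E.ω₀ ^ 2) * ((y.2 l) ^ 2 + (y.1 l) ^ 2) ≤ A₂ * nuv := by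
      rw [add_comm ((y.2 l) ^ 2)]; exact hc1
    constructor
    · rw [e1]
      have : E.bl₁ y l = -(1 / E.ρ) * y.1 l + E.ω₀ * y.2 l := rfl
      rw [this]
      linarith
    · rw [e2]
      have : E.bl₂ y l = -(1 / E.ρ) * y.2 l + -E.ω₀ * y.1 l := by unfold bl₂; ring
      rw [this]
      linarith
  -- assemble the sup-norm bound
  have hrhs : 0 ≤ Real.sqrt (A₁ + A₂) * Real.sqrt nuv :=
    mul_nonneg (Real.sqrt_nonneg _) (Real.sqrt_nonneg _)
  have hsq : (Real.sqrt (A₁ + A₂) * Real.sqrt nuv) ^ 2 = (A₁ + A₂) * nuv := by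
    rw [mul_pow, Real.sq_sqrt (by positivity), Real.sq_sqrt hnu0]
  have coord : ∀ z : ℝ, z ^ 2 ≤ (A₁ + A₂) * nuv → ‖z‖ ≤ Real.sqrt (A₁ + A₂) * Real.sqrt nuv :=
    fun z hz => by
      rw [Real.norm_eq_abs]
      exact abs_le_of_sq_le_sq (by rw [hsq]; exact hz) hrhs
  show ‖E.fullField W x‖ ≤ Real.sqrt (A₁ + A₂) * Real.sqrt nuv
  rw [Prod.norm_def, max_le_iff]
  constructor
  · show ‖E.fvVec W x.1 x.2‖ ≤ _
    rw [Prod.norm_def, max_le_iff]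
    exact ⟨(pi_norm_le_iff_of_nonneg hrhs).2 fun k => coord _ (hv_coord k).1,
      (pi_norm_le_iff_of_nonneg hrhs).2 fun k => coord _ (hv_coord k).2⟩
  · show ‖E.fiVec x.1 x.2‖ ≤ _
    rw [Prod.norm_def, max_le_iff]
    exact ⟨(pi_norm_le_iff_of_nonneg hrhs).2 fun l => coord _ (hi_coord l).1,
      (pi_norm_le_iff_of_nonneg hrhs).2 fun l => coord _ (hi_coord l).2⟩

/-! ## §4 The amplitude window along solutions approaching `𝒯`, and the exponential displacement bound -/

/-- Along a curve approaching `𝒯` the amplitudes eventually stay in the window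
`v_k*²/2 ≤ ‖v_k(t)‖² ≤ 2v_k*²` (all `k`; `N ≥ 1`, `v_k* ≠ 0`). [cite: GrossEtAl2019, §II-C (7) with
§IV-A (16)] -/
theorem exists_forall_nearAmp [NeZero N] (hne : ∀ k, W.vref k ≠ 0)
    {γ : ℝ → DvocState N × LineState M}
    (hT : Tendsto (fun t => infDist (γ t) (E.target W)) atTop (𝓝 0)) :
    ∃ T, 0 ≤ T ∧ ∀ t, T ≤ t → ∀ k,
      W.vref k ^ 2 / 2 ≤ dvocNsq (γ t).1 k ∧ dvocNsq (γ t).1 k ≤ 2 * W.vref k ^ 2 := by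
  have hk : ∀ k, ∀ᶠ t in atTop,
      W.vref k ^ 2 / 2 ≤ dvocNsq (γ t).1 k ∧ dvocNsq (γ t).1 k ≤ 2 * W.vref k ^ 2 := by
    intro k
    have hP : 0 < W.vref k ^ 2 := by have := hne k; positivity
    have hlim := E.tendsto_nsq_of_tendsto_infDist_target W hne hT k
    have hmem : Set.Icc (W.vref k ^ 2 / 2) (2 * W.vref k ^ 2) ∈ 𝓝 (W.vref k ^ 2) :=
      Icc_mem_nhds (by linarith) (by linarith)
    exact (hlim.eventually hmem).mono fun t ht => ⟨ht.1, ht.2⟩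
  have hall := (Filter.eventually_all.2 hk).and (eventually_ge_atTop (0 : ℝ))
  obtain ⟨T, hT'⟩ := Filter.eventually_atTop.1 hall
  exact ⟨max T 0, le_max_right _ _, fun t ht k => (hT' t ((le_max_left _ _).trans ht)).1 k⟩

/-- A solution of (15) on `[0, ∞)` is continuous on `[0, ∞)`. [cite: GrossEtAl2019, eq. (15)] -/
theorem continuousOn_of_isSolutionOn {γ : ℝ → DvocState N × LineState M}
    (hsol : E.IsSolutionOn W γ (Ici 0)) : ContinuousOn γ (Ici 0) :=
  fun t ht => (hsol t ht).continuousWithinAt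

/-- **The displacement after time `s` is exponentially small**: with the amplitude window holding on
`[T, ∞)` (`T ≥ 0`) and `K` the velocity-bound constant of `exists_fullField_bound`, for `T ≤ s ≤ t`:
`‖x(t) − x(s)‖ ≤ (2K√ν(x(T))/μ) e^{−(μ/2)(s−T)}` (mean-value inequality with
`‖f(x(τ))‖ ≤ K√ν(x(τ)) ≤ K√ν(x(T)) e^{−(μ/2)(τ−T)}`). [cite: GrossEtAl2019, Prop. 7 with (15)]
MODELLED: model (15). -/
theorem norm_sub_le_of_nearAmp [NeZero N] (h : E.Consistent W) (hC : E.IsCycle C) (hρ : 0 < E.ρ)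
    (ha : ∀ l, 0 < E.a l) (hη : 0 < W.η) (hα : 0 < W.α) (hv : ∀ k, 0 < W.vref k) {c κ₀ Υ : ℝ}
    (hc : 0 < c) (hκ₀ : 0 < κ₀) (hcκ : c ≤ κ₀) (hΥ : 0 < Υ) (h23 : W.DecreaseOnS c)
    (hK : W.PhaseErrorBound κ₀) (hY : E.AdmittanceBound Υ) (h35 : W.η < c / (E.ρ * Υ * (c + 5 * κ₀)))
    {K : ℝ} (hK0 : 0 ≤ K)
    (hKb : ∀ x : DvocState N × LineState M, (∀ k, dvocNsq x.1 k ≤ 2 * W.vref k ^ 2) →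
      ‖E.fullField W x‖ ≤ K * Real.sqrt (E.nu W C (E.dWeight κ₀ Υ) (W.alpha1 c κ₀) x))
    {γ : ℝ → DvocState N × LineState M} (hsol : E.IsSolutionOn W γ (Ici 0)) {T : ℝ} (hT0 : 0 ≤ T)
    (hR : ∀ τ, T ≤ τ → ∀ k,
      W.vref k ^ 2 / 2 ≤ dvocNsq (γ τ).1 k ∧ dvocNsq (γ τ).1 k ≤ 2 * W.vref k ^ 2)
    {s t : ℝ} (hs : T ≤ s) (hst : s ≤ t) :
    ‖γ t - γ s‖ ≤ 2 * K * Real.sqrt (E.nu W C (E.dWeight κ₀ Υ) (W.alpha1 c κ₀) (γ T))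
        / E.lineDecayRate W c κ₀ Υ
        * Real.exp (-(E.lineDecayRate W c κ₀ Υ / 2) * (s - T)) := by
  set d := E.dWeight κ₀ Υ with hddef
  set α₁ := W.alpha1 c κ₀ with hα₁def
  set μ := E.lineDecayRate W c κ₀ Υ with hμdef
  set VT := E.nu W C d α₁ (γ T) with hVT
  have hμ0 : 0 < μ := E.lineDecayRate_pos W hρ hη hα hc hκ₀ hΥ h35
  have hΛ : W.Lam ≠ 0 := (W.Lam_pos hv).ne'
  obtain ⟨hd0, hd1⟩ := E.dWeight_mem_Ioo hρ hκ₀ hΥ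
  have hα₁ : 0 < α₁ := by rw [hα₁def]; unfold DvocReduced.alpha1; positivity
  have hV0 : 0 ≤ VT :=
    E.nu_nonneg W C hΛ hρ.le hd0.le hd1.le (by positivity : 0 ≤ W.η * W.α * α₁) (γ T)
  set Cst := K * Real.sqrt VT * (2 / μ) with hCst
  have h2μ : 2 / μ * (μ / 2) = 1 := by
    rw [div_mul_div_comm, mul_comm 2 μ, div_self (mul_ne_zero hμ0.ne' two_ne_zero)]
  set B : ℝ → ℝ := fun τ => Cst * (Real.exp (-(μ / 2) * (s - T)) - Real.exp (-(μ / 2) * (τ - T)))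
    with hBdef
  set B' : ℝ → ℝ := fun τ => K * Real.sqrt VT * Real.exp (-(μ / 2) * (τ - T)) with hB'def
  have hB : ∀ x, HasDerivAt B (B' x) x := by
    intro x
    have h1 : HasDerivAt (fun τ => -(μ / 2) * (τ - T)) (-(μ / 2) * 1) x :=
      ((hasDerivAt_id x).sub_const T).const_mul _
    have h2 := (h1.exp.const_sub (Real.exp (-(μ / 2) * (s - T)))).const_mul Cst
    refine h2.congr_deriv ?_
    rw [hB'def]
    calc Cst * -(Real.exp (-(μ / 2) * (x - T)) * (-(μ / 2) * 1))
        = K * Real.sqrt VT * Real.exp (-(μ / 2) * (x - T)) * (2 / μ * (μ / 2)) := by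
          rw [hCst]; ring
      _ = K * Real.sqrt VT * Real.exp (-(μ / 2) * (x - T)) := by rw [h2μ, mul_one]
  have hcont : ContinuousOn (fun τ => γ τ - γ s) (Icc s t) :=
    ((E.continuousOn_of_isSolutionOn W hsol).mono fun τ hτ => hT0.trans (hs.trans hτ.1)).sub
      continuousOn_const
  have hderiv : ∀ x ∈ Ico s t, HasDerivWithinAt (fun τ => γ τ - γ s) (E.fullField W (γ x)) (Ici x) x := by
    intro x hx
    have h0x : (0 : ℝ) ≤ x := hT0.trans (hs.trans hx.1)
    exact ((hsol x h0x).mono fun σ hσ => h0x.trans hσ).sub_const _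
  have hbound : ∀ x ∈ Ico s t, ‖E.fullField W (γ x)‖ ≤ B' x := by
    intro x hx
    have hTx : T ≤ x := hs.trans hx.1
    have h1 := hKb (γ x) (fun k => (hR x hTx k).2)
    have h2 := E.nu_le_mul_exp_neg W C h hC hρ ha hη hα hv hc hκ₀ hcκ hΥ h23 hK hY h35 hsol hT0
      (fun τ hτ k => (hR τ hτ k).1) hTx
    have h3 : Real.sqrt (E.nu W C d α₁ (γ x)) ≤ Real.sqrt VT * Real.exp (-(μ / 2) * (x - T)) := by
      have hsq : (Real.sqrt VT * Real.exp (-(μ / 2) * (x - T))) ^ 2 = VT * Real.exp (-μ * (x - T)) := by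
        rw [mul_pow, Real.sq_sqrt hV0, ← Real.exp_nat_mul]
        congr 1; push_cast; ring
      have hnn : 0 ≤ Real.sqrt VT * Real.exp (-(μ / 2) * (x - T)) :=
        mul_nonneg (Real.sqrt_nonneg _) (Real.exp_pos _).le
      rw [← Real.sqrt_sq hnn, hsq]
      exact Real.sqrt_le_sqrt h2
    calc ‖E.fullField W (γ x)‖ ≤ K * Real.sqrt (E.nu W C d α₁ (γ x)) := h1
      _ ≤ K * (Real.sqrt VT * Real.exp (-(μ / 2) * (x - T))) := mul_le_mul_of_nonneg_left h3 hK0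
      _ = B' x := by rw [hB'def]; ring
  have hmain := image_norm_le_of_norm_deriv_right_le_deriv_boundary hcont hderiv
    (B := B) (B' := B') (by simp [hBdef]) hB hbound (right_mem_Icc.2 hst)
  have hdrop : B t ≤ Cst * Real.exp (-(μ / 2) * (s - T)) := by
    have hCnn : 0 ≤ Cst := by rw [hCst]; positivity
    have : 0 ≤ Cst * Real.exp (-(μ / 2) * (t - T)) := mul_nonneg hCnn (Real.exp_pos _).le
    simp only [hBdef]
    nlinarith
  calc ‖γ t - γ s‖ ≤ B t := hmain
    _ ≤ Cst * Real.exp (-(μ / 2) * (s - T)) := hdrop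
    _ = 2 * K * Real.sqrt VT / μ * Real.exp (-(μ / 2) * (s - T)) := by rw [hCst]; ring

/-! ## §5 Convergence to ONE synchronous steady state -/

/-- **Convergence to a point of `𝒯`** (with the cycle matrix explicit): under the hypotheses of
`tendsto_infDist_target_or_tendsto_zero`, every solution of (15) on `[0, ∞)` that approaches `𝒯`
converges to a POINT `x_∞ ∈ 𝒯` — a rest point of the rotating-frame dynamics (objective (6)).
[cite: GrossEtAl2019, Thm. 2 with §II-C (6) and §V-B] MODELLED: model (15); nothing here is a grid. -/
theorem exists_tendsto_of_tendsto_infDist_target' [NeZero N] (h : E.Consistent W) (hC : E.IsCycle C)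
    (hspan : E.SpansCycles C) (hρ : 0 < E.ρ) (ha : ∀ l, 0 < E.a l) (hη : 0 < W.η) (hα : 0 < W.α)
    (hv : ∀ k, 0 < W.vref k) {c κ₀ Υ : ℝ} (hc : 0 < c) (hκ₀ : 0 < κ₀) (hcκ : c ≤ κ₀) (hΥ : 0 < Υ)
    (h23 : W.DecreaseOnS c) (hK : W.PhaseErrorBound κ₀) (hY : E.AdmittanceBound Υ)
    (h35 : W.η < c / (E.ρ * Υ * (c + 5 * κ₀)))
    {γ : ℝ → DvocState N × LineState M} (hsol : E.IsSolutionOn W γ (Ici 0))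
    (hT : Tendsto (fun t => infDist (γ t) (E.target W)) atTop (𝓝 0)) :
    ∃ x, x ∈ E.target W ∧ Tendsto γ atTop (𝓝 x) := by
  have hne : ∀ k, W.vref k ≠ 0 := fun k => (hv k).ne'
  obtain ⟨T, hT0, hR⟩ := E.exists_forall_nearAmp W hne hT
  obtain ⟨K, hK0, hKb⟩ := E.exists_fullField_bound W C h hspan hρ ha hη hα hv hc hκ₀ hΥ hK
  set μ := E.lineDecayRate W c κ₀ Υ with hμdef
  have hμ0 : 0 < μ := E.lineDecayRate_pos W hρ hη hα hc hκ₀ hΥ h35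
  set Cst := 2 * K * Real.sqrt (E.nu W C (E.dWeight κ₀ Υ) (W.alpha1 c κ₀) (γ T)) / μ with hCst
  have hCnn : 0 ≤ Cst := by rw [hCst]; positivity
  have hdisp : ∀ s t, T ≤ s → s ≤ t → ‖γ t - γ s‖ ≤ Cst * Real.exp (-(μ / 2) * (s - T)) :=
    fun s t hs hst => E.norm_sub_le_of_nearAmp W C h hC hρ ha hη hα hv hc hκ₀ hcκ hΥ h23 hK hY h35
      hK0 hKb hsol hT0 hR hs hst
  have htail : Tendsto (fun s => Cst * Real.exp (-(μ / 2) * (s - T))) atTop (𝓝 0) := by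
    have h1 : Tendsto (fun s : ℝ => -(μ / 2) * (s - T)) atTop atBot := by
      have : Tendsto (fun s : ℝ => s - T) atTop atTop := tendsto_atTop_add_const_right _ _ tendsto_id
      exact this.const_mul_atTop_of_neg (by linarith)
    have h2 := Real.tendsto_exp_atBot.comp h1
    simpa using h2.const_mul Cst
  have hcauchy : Cauchy (map γ atTop) := by
    refine Metric.cauchy_iff.2 ⟨map_neBot, fun ε hε => ?_⟩
    have hev : ∀ᶠ s in atTop, Cst * Real.exp (-(μ / 2) * (s - T)) < ε / 2 :=
      (tendsto_order.1 htail).2 _ (by linarith)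
    obtain ⟨s₀, hs₀⟩ := Filter.eventually_atTop.1 (hev.and (eventually_ge_atTop T))
    refine ⟨γ '' Ici s₀, image_mem_map (Ici_mem_atTop s₀), ?_⟩
    rintro x ⟨a, ha', rfl⟩ y ⟨b, hb, rfl⟩
    obtain ⟨h0, hT'⟩ := hs₀ s₀ le_rfl
    have h1 := hdisp s₀ a hT' ha'
    have h2 := hdisp s₀ b hT' hb
    calc dist (γ a) (γ b) = ‖(γ a - γ s₀) - (γ b - γ s₀)‖ := by rw [dist_eq_norm]; congr 1; abel
      _ ≤ ‖γ a - γ s₀‖ + ‖γ b - γ s₀‖ := norm_sub_le _ _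
      _ < ε := by linarith
  obtain ⟨x, hxlim⟩ := cauchy_map_iff_exists_tendsto.1 hcauchy
  refine ⟨x, ?_, hxlim⟩
  have hTne : (E.target W).Nonempty := by
    rw [E.target_eq_image W hne]
    exact ⟨_, ⟨(1, 0), by norm_num, rfl⟩⟩
  have hlim2 : Tendsto (fun t => infDist (γ t) (E.target W)) atTop (𝓝 (infDist x (E.target W))) :=
    ((continuous_infDist_pt (E.target W)).tendsto x).comp hxlim
  have h0 : infDist x (E.target W) = 0 := tendsto_nhds_unique hlim2 hT
  exact ((E.isCompact_target W hne).isClosed.mem_iff_infDist_zero hTne).2 h0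

/-- **Exponential tail of the convergence** (cycle matrix explicit): with `x_∞` the limit, `T` a time
from which the amplitude window holds, `K` the velocity constant and `C = 2K√ν(x(T))/μ`, for every
`s ≥ T`: `‖x_∞ − x(s)‖ ≤ C e^{−(μ/2)(s−T)}`. [cite: GrossEtAl2019, Thm. 2 / Prop. 7 with §V-B]
MODELLED: model (15). -/
theorem norm_sub_lim_le [NeZero N] (h : E.Consistent W) (hC : E.IsCycle C) (hρ : 0 < E.ρ)
    (ha : ∀ l, 0 < E.a l) (hη : 0 < W.η) (hα : 0 < W.α) (hv : ∀ k, 0 < W.vref k) {c κ₀ Υ : ℝ}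
    (hc : 0 < c) (hκ₀ : 0 < κ₀) (hcκ : c ≤ κ₀) (hΥ : 0 < Υ) (h23 : W.DecreaseOnS c)
    (hK : W.PhaseErrorBound κ₀) (hY : E.AdmittanceBound Υ) (h35 : W.η < c / (E.ρ * Υ * (c + 5 * κ₀)))
    {K : ℝ} (hK0 : 0 ≤ K)
    (hKb : ∀ x : DvocState N × LineState M, (∀ k, dvocNsq x.1 k ≤ 2 * W.vref k ^ 2) →
      ‖E.fullField W x‖ ≤ K * Real.sqrt (E.nu W C (E.dWeight κ₀ Υ) (W.alpha1 c κ₀) x))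
    {γ : ℝ → DvocState N × LineState M} (hsol : E.IsSolutionOn W γ (Ici 0)) {T : ℝ} (hT0 : 0 ≤ T)
    (hR : ∀ τ, T ≤ τ → ∀ k,
      W.vref k ^ 2 / 2 ≤ dvocNsq (γ τ).1 k ∧ dvocNsq (γ τ).1 k ≤ 2 * W.vref k ^ 2)
    {x : DvocState N × LineState M} (hlim : Tendsto γ atTop (𝓝 x)) {s : ℝ} (hs : T ≤ s) :
    ‖x - γ s‖ ≤ 2 * K * Real.sqrt (E.nu W C (E.dWeight κ₀ Υ) (W.alpha1 c κ₀) (γ T))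
        / E.lineDecayRate W c κ₀ Υ
        * Real.exp (-(E.lineDecayRate W c κ₀ Υ / 2) * (s - T)) := by
  have hcont : Tendsto (fun t => ‖γ t - γ s‖) atTop (𝓝 ‖x - γ s‖) :=
    (continuous_norm.tendsto _).comp (hlim.sub_const (γ s))
  refine le_of_tendsto hcont ?_
  filter_upwards [eventually_ge_atTop s] with t hst
  exact E.norm_sub_le_of_nearAmp W C h hC hρ ha hη hα hv hc hκ₀ hcκ hΥ h23 hK hY h35 hK0 hKb hsol hT0
    hR hs hst

/-- **Region of attraction, pointwise form** (cycle matrix explicit): every solution of (15) on `[0, ∞)`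
with `ν(x(0)) < ν(0ₙ)` converges to a single point of `𝒯`. [cite: GrossEtAl2019, Thm. 2 (proof) with
§II-C (6)] MODELLED: model (15). -/
theorem exists_tendsto_of_nu_lt [NeZero N] (h : E.Consistent W) (hC : E.IsCycle C)
    (hspan : E.SpansCycles C) (hρ : 0 < E.ρ) (ha : ∀ l, 0 < E.a l) (hη : 0 < W.η) (hα : 0 < W.α)
    (hv : ∀ k, 0 < W.vref k) {c κ₀ Υ : ℝ} (hc : 0 < c) (hκ₀ : 0 < κ₀) (hcκ : c ≤ κ₀) (hΥ : 0 < Υ)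
    (h23 : W.DecreaseOnS c) (hK : W.PhaseErrorBound κ₀) (hY : E.AdmittanceBound Υ)
    (h35 : W.η < c / (E.ρ * Υ * (c + 5 * κ₀)))
    {γ : ℝ → DvocState N × LineState M} (hsol : E.IsSolutionOn W γ (Ici 0))
    (hlt : E.nu W C (E.dWeight κ₀ Υ) (W.alpha1 c κ₀) (γ 0)
      < E.nu W C (E.dWeight κ₀ Υ) (W.alpha1 c κ₀) 0) :
    ∃ x, x ∈ E.target W ∧ Tendsto γ atTop (𝓝 x) :=
  E.exists_tendsto_of_tendsto_infDist_target' W C h hC hspan hρ ha hη hα hv hc hκ₀ hcκ hΥ h23 hK hY h35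
    hsol (E.tendsto_infDist_target_of_nu_lt W C h hC hspan hρ ha hη hα hv hc hκ₀ hcκ hΥ h23 hK hY h35
      hsol hlt)

/-- **Point convergence with an explicit exponential tail** (cycle matrix explicit): every solution of
(15) on `[0, ∞)` approaching `𝒯` converges to some `x_∞ ∈ 𝒯`, and from some time `T` on
`‖x_∞ − x(s)‖ ≤ C e^{−(μ/2)(s−T)}` with `μ = lineDecayRate` and some `C ≥ 0`.
[cite: GrossEtAl2019, Thm. 2 with §II-C (6); §V-B] MODELLED: model (15). -/
theorem exists_tendsto_expTail' [NeZero N] (h : E.Consistent W) (hC : E.IsCycle C)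
    (hspan : E.SpansCycles C) (hρ : 0 < E.ρ) (ha : ∀ l, 0 < E.a l) (hη : 0 < W.η) (hα : 0 < W.α)
    (hv : ∀ k, 0 < W.vref k) {c κ₀ Υ : ℝ} (hc : 0 < c) (hκ₀ : 0 < κ₀) (hcκ : c ≤ κ₀) (hΥ : 0 < Υ)
    (h23 : W.DecreaseOnS c) (hK : W.PhaseErrorBound κ₀) (hY : E.AdmittanceBound Υ)
    (h35 : W.η < c / (E.ρ * Υ * (c + 5 * κ₀)))
    {γ : ℝ → DvocState N × LineState M} (hsol : E.IsSolutionOn W γ (Ici 0))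
    (hT : Tendsto (fun t => infDist (γ t) (E.target W)) atTop (𝓝 0)) :
    ∃ x, x ∈ E.target W ∧ Tendsto γ atTop (𝓝 x) ∧ ∃ T C : ℝ, 0 ≤ C ∧ ∀ s, T ≤ s →
      ‖x - γ s‖ ≤ C * Real.exp (-(E.lineDecayRate W c κ₀ Υ / 2) * (s - T)) := by
  have hne : ∀ k, W.vref k ≠ 0 := fun k => (hv k).ne'
  obtain ⟨x, hx, hlim⟩ := E.exists_tendsto_of_tendsto_infDist_target' W C h hC hspan hρ ha hη hα hv
    hc hκ₀ hcκ hΥ h23 hK hY h35 hsol hT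
  obtain ⟨T, hT0, hR⟩ := E.exists_forall_nearAmp W hne hT
  obtain ⟨K, hK0, hKb⟩ := E.exists_fullField_bound W C h hspan hρ ha hη hα hv hc hκ₀ hΥ hK
  have hμ0 : 0 < E.lineDecayRate W c κ₀ Υ := E.lineDecayRate_pos W hρ hη hα hc hκ₀ hΥ h35
  refine ⟨x, hx, hlim, T,
    2 * K * Real.sqrt (E.nu W C (E.dWeight κ₀ Υ) (W.alpha1 c κ₀) (γ T)) / E.lineDecayRate W c κ₀ Υ,
    by positivity, fun s hs => ?_⟩
  exact E.norm_sub_lim_le W C h hC hρ ha hη hα hv hc hκ₀ hcκ hΥ h23 hK hY h35 hK0 hKb hsol hT0 hR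
    hlim hs

end pointConvergence

/-! ## §6 Theorem 2, pointwise form, from the network and control data alone -/

section packaged

/-- **Convergence to a point of `𝒯`, from the data alone**: under the hypotheses of `thm2_dichotomy`,
every solution of (15) on `[0, ∞)` that approaches `𝒯` converges to a point of `𝒯` (the cycle matrix
is supplied by `exists_isCycle_spansCycles`). [cite: GrossEtAl2019, Thm. 2 with §II-C (6)]
MODELLED: model (15). -/
theorem exists_tendsto_of_tendsto_infDist_target [NeZero N] (h : E.Consistent W) (hρ : 0 < E.ρ)
    (ha : ∀ l, 0 < E.a l) (hη : 0 < W.η) (hα : 0 < W.α) (hv : ∀ k, 0 < W.vref k) {c κ₀ Υ : ℝ}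
    (hc : 0 < c) (hκ₀ : 0 < κ₀) (hcκ : c ≤ κ₀) (hΥ : 0 < Υ) (h23 : W.DecreaseOnS c)
    (hK : W.PhaseErrorBound κ₀) (hY : E.AdmittanceBound Υ) (h35 : W.η < c / (E.ρ * Υ * (c + 5 * κ₀)))
    {γ : ℝ → DvocState N × LineState M} (hsol : E.IsSolutionOn W γ (Ici 0))
    (hT : Tendsto (fun t => infDist (γ t) (E.target W)) atTop (𝓝 0)) :
    ∃ x, x ∈ E.target W ∧ Tendsto γ atTop (𝓝 x) := by
  obtain ⟨M₀, C, hC, hspan⟩ := E.exists_isCycle_spansCycles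
  exact E.exists_tendsto_of_tendsto_infDist_target' W C h hC hspan hρ ha hη hα hv hc hκ₀ hcκ hΥ h23 hK
    hY h35 hsol hT

/-- **THEOREM 2, POINTWISE FORM** [cite: GrossEtAl2019, Thm. 2 with §II-C (6); §V-B]: for `N ≥ 1`
converters and `M` lines (Assumption 1, consistency, `‖Y_l‖ > 0`, `ρ > 0`), gains `η, α > 0`,
set-points `v_k* > 0`, a margin `c > 0` with (23), bounds `κ₀ ≥ ‖𝒦 − 𝓛‖` (`c ≤ κ₀`), `Υ ≥ ‖𝒴‖` and
the gain condition (35), EVERY solution `x(t) = (v(t), i(t))` of the full-order model (15) on `[0, ∞)`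
CONVERGES — either to `0ₙ` (voltage collapse, the print's measure-zero exception) or to ONE synchronous
steady state `x_∞ ∈ 𝒯`, `x_∞ = (S(a,b), i^s(S(a,b)))` with `a² + b² = 1`: every converter phase-locked
at the prescribed relative angles with amplitude `v_k*`, every line at its quasi-steady-state current,
all rotating at `ω₀` in the static frame (the print: convergence to the SET `𝒯`; the point version is
derived here from its Prop. 7 / Prop. 4 / (24)). MODELLED: model (15); nothing here is a grid, and no
declaration says «stable». -/
theorem thm2_exists_tendsto [NeZero N] (h : E.Consistent W) (hρ : 0 < E.ρ) (ha : ∀ l, 0 < E.a l)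
    (hη : 0 < W.η) (hα : 0 < W.α) (hv : ∀ k, 0 < W.vref k) {c κ₀ Υ : ℝ} (hc : 0 < c) (hκ₀ : 0 < κ₀)
    (hcκ : c ≤ κ₀) (hΥ : 0 < Υ) (h23 : W.DecreaseOnS c) (hK : W.PhaseErrorBound κ₀)
    (hY : E.AdmittanceBound Υ) (h35 : W.η < c / (E.ρ * Υ * (c + 5 * κ₀)))
    {γ : ℝ → DvocState N × LineState M} (hsol : E.IsSolutionOn W γ (Ici 0)) :
    Tendsto γ atTop (𝓝 0) ∨ ∃ x, x ∈ E.target W ∧ Tendsto γ atTop (𝓝 x) := by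
  rcases E.thm2_dichotomy W h hρ ha hη hα hv hc hκ₀ hcκ hΥ h23 hK hY h35 hsol with hT | h0
  · exact Or.inr (E.exists_tendsto_of_tendsto_infDist_target W h hρ ha hη hα hv hc hκ₀ hcκ hΥ h23 hK
      hY h35 hsol hT)
  · exact Or.inl h0

/-- **THEOREM 2, POINTWISE WITH EXPONENTIAL TAIL, from the data alone**: under the hypotheses of
`thm2_exists_tendsto`, every solution of (15) on `[0, ∞)` tends to `0ₙ`, or converges to ONE
synchronous steady state `x_∞ ∈ 𝒯` with `‖x_∞ − x(s)‖ ≤ C e^{−(μ/2)(s−T)}` for all `s ≥ T`, for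
some `T`, some `C ≥ 0` and the explicit rate `μ = lineDecayRate` (`> 0`, `lineDecayRate_pos`).
[cite: GrossEtAl2019, Thm. 2 with §II-C (6); §V-B («exponential phase stability»)] MODELLED: model (15);
the rate constant is the kernel's, not a printed one; nothing here is a grid. -/
theorem thm2_exists_tendsto_expTail [NeZero N] (h : E.Consistent W) (hρ : 0 < E.ρ)
    (ha : ∀ l, 0 < E.a l) (hη : 0 < W.η) (hα : 0 < W.α) (hv : ∀ k, 0 < W.vref k) {c κ₀ Υ : ℝ}
    (hc : 0 < c) (hκ₀ : 0 < κ₀) (hcκ : c ≤ κ₀) (hΥ : 0 < Υ) (h23 : W.DecreaseOnS c)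
    (hK : W.PhaseErrorBound κ₀) (hY : E.AdmittanceBound Υ) (h35 : W.η < c / (E.ρ * Υ * (c + 5 * κ₀)))
    {γ : ℝ → DvocState N × LineState M} (hsol : E.IsSolutionOn W γ (Ici 0)) :
    Tendsto γ atTop (𝓝 0) ∨ ∃ x, x ∈ E.target W ∧ Tendsto γ atTop (𝓝 x) ∧ ∃ T C : ℝ, 0 ≤ C ∧
      ∀ s, T ≤ s → ‖x - γ s‖ ≤ C * Real.exp (-(E.lineDecayRate W c κ₀ Υ / 2) * (s - T)) := by
  rcases E.thm2_dichotomy W h hρ ha hη hα hv hc hκ₀ hcκ hΥ h23 hK hY h35 hsol with hT | h0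
  · obtain ⟨M₀, C, hC, hspan⟩ := E.exists_isCycle_spansCycles
    exact Or.inr (E.exists_tendsto_expTail' W C h hC hspan hρ ha hη hα hv hc hκ₀ hcκ hΥ h23 hK hY
      h35 hsol hT)
  · exact Or.inl h0

end packaged

/-! ## §7 The limit steady state meets the control objectives exactly -/

section limitObjectives

/-- **At the limit the control objectives hold EXACTLY (full-order model (15))**: under the hypotheses
of `thm2_exists_tendsto`, every solution of (15) on `[0, ∞)` tends to `0ₙ` or converges to a point
`x_∞ = (v_∞, i_∞) ∈ 𝒯` which is a REST POINT of the rotating-frame dynamics (15) (`f(x_∞) = 0` —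
objective (6): in the static frame a pure sinusoid of frequency `ω₀`), has the prescribed relative
angles `v_∞ ∈ 𝒮` (objective (5)), `‖v_∞,k‖² = v_k*²` for every converter (objective (7)), line
currents at quasi-steady state `i_∞ = i^s(v_∞)`, and delivers EXACTLY the consistent power set-points
`p_k = p_k*`, `q_k = q_k*` at `κ = tan⁻¹(ρω₀)` (objective (8), Definition 2's instantaneous powers —
tree `instP`/`instQ`, `pSet`/`qSet`). [cite: GrossEtAl2019, §II-C (5)–(8) with Thm. 2 and §IV-A (16)]
MODELLED: model (15); nothing here is a grid. -/
theorem thm2_limit_objectives [NeZero N] (h : E.Consistent W) (hρ : 0 < E.ρ) (ha : ∀ l, 0 < E.a l)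
    (hη : 0 < W.η) (hα : 0 < W.α) (hv : ∀ k, 0 < W.vref k) {c κ₀ Υ : ℝ} (hc : 0 < c) (hκ₀ : 0 < κ₀)
    (hcκ : c ≤ κ₀) (hΥ : 0 < Υ) (h23 : W.DecreaseOnS c) (hK : W.PhaseErrorBound κ₀)
    (hY : E.AdmittanceBound Υ) (h35 : W.η < c / (E.ρ * Υ * (c + 5 * κ₀)))
    {γ : ℝ → DvocState N × LineState M} (hsol : E.IsSolutionOn W γ (Ici 0)) :
    Tendsto γ atTop (𝓝 0) ∨ ∃ x, Tendsto γ atTop (𝓝 x) ∧ x ∈ E.target W ∧ E.fullField W x = 0 ∧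
      W.InS x.1 ∧ (∀ k, dvocNsq x.1 k = W.vref k ^ 2) ∧ x.2 = E.iss x.1 ∧
      ∀ k, E.instP x k = W.pSet (Real.arctan (E.ρ * E.ω₀)) k ∧
        E.instQ x k = W.qSet (Real.arctan (E.ρ * E.ω₀)) k := by
  have hne : ∀ k, W.vref k ≠ 0 := fun k => (hv k).ne'
  rcases E.thm2_exists_tendsto W h hρ ha hη hα hv hc hκ₀ hcκ hΥ h23 hK hY h35 hsol with h0 | ⟨x, hx, hlim⟩
  · exact Or.inl h0
  · have hT : E.InT W x := hx
    exact Or.inr ⟨x, hlim, hx, E.fullField_eq_zero_of_InT W h hρ.ne' (fun l => (ha l).ne') hne hT,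
      hT.1, hT.2.1, hT.2.2, fun k => E.instP_of_InT W h hne hT k⟩

end limitObjectives

end DvocLines

namespace DvocReduced

/-! ## §8 Reduced model (17): the limit steady state meets the control objectives exactly -/

variable {N : ℕ} (W : DvocReduced N)

/-- **At the limit the control objectives hold EXACTLY (reduced model (17))**: under the hypotheses
of `tendsto_zero_or_exists_tendsto`, every solution of (17) on `[0, ∞)` tends to `0` or converges to
a point `v_∞ ∈ 𝒮 ∩ 𝒜` which is a REST POINT of (17) (`f(v_∞) = 0` — objective (6)), has the
prescribed relative angles `v_∞ ∈ 𝒮` ((5)), `‖v_∞,k‖² = v_k*²` ((7)), and delivers EXACTLY the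
consistent set-points `p_k = p_k*`, `q_k = q_k*` at EVERY `κ` under Definition 1's quasi-steady-state
network ((8); tree `instPqs`/`instQqs`, `pSet`/`qSet`). [cite: GrossEtAl2019, §II-C (5)–(8) with
Prop. 3 / Thm. 2] MODELLED: reduced model (17); nothing here is a grid. -/
theorem limit_objectives [NeZero N] (hη : 0 < W.η) (hα : 0 < W.α) (hv : ∀ k, 0 < W.vref k)
    {c κ₀ : ℝ} (hc : 0 < c) (hκ₀ : 0 < κ₀) (h23 : W.DecreaseOnS c) (hK : W.PhaseErrorBound κ₀)
    {γ : ℝ → DvocState N} (hsol : W.IsSolutionOn γ (Ici 0)) :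
    Tendsto γ atTop (𝓝 0) ∨ ∃ v, Tendsto γ atTop (𝓝 v) ∧ v ∈ W.target ∧ W.field v = 0 ∧ W.InS v ∧
      (∀ k, dvocNsq v k = W.vref k ^ 2) ∧
      ∀ κ k, W.instPqs κ v k = W.pSet κ k ∧ W.instQqs κ v k = W.qSet κ k := by
  have hne : ∀ k, W.vref k ≠ 0 := fun k => (hv k).ne'
  rcases W.tendsto_zero_or_exists_tendsto hη hα hv hc hκ₀ h23 hK hsol with h0 | ⟨v, hvT, hlim⟩
  · exact Or.inl h0
  · exact Or.inr ⟨v, hlim, hvT, W.field_eq_zero_of_mem_target hne hvT, hvT.1, hvT.2,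
      fun κ k => W.instPqs_of_mem_target hvT hne κ k⟩

end DvocReduced

end Literature.MathematicalPhysics.PowerSystems

namespace Literature.MathematicalPhysics.PowerSystems

open Real Finset Set Filter Metric
open scoped _root_.Topology

/-! ## §9 Exponential convergence OF THE DISTANCE to `𝒯` (full-order (15)) and to `𝒮 ∩ 𝒜` (reduced
(17)) after finite time — the set-level statements of Theorem 2 / Prop. 3 with an explicit rate
(append 2026-08-27; corollaries of the `…_expTail` theorems, `infDist ≤ dist` to the limit point) -/

namespace DvocLines

variable {N M : ℕ} (E : DvocLines N M) (W : DvocReduced N)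

/-- **Theorem 2 with an explicit exponential rate for the distance to `𝒯`, from the data alone**:
under the hypotheses of `thm2_exists_tendsto`, every solution of (15) on `[0, ∞)` tends to `0ₙ`, or
there are a time `T` and `C ≥ 0` with `dist(x(s), 𝒯) ≤ C e^{−(μ/2)(s−T)}` for all `s ≥ T`
(`μ = lineDecayRate > 0`). The print's Theorem 2 states asymptotic (not exponential) convergence to
`𝒯` for (15); the rate is the kernel's. [cite: GrossEtAl2019, Thm. 2; §V-B] MODELLED: model (15);
nothing here is a grid. -/
theorem thm2_infDist_expDecay [NeZero N] (h : E.Consistent W) (hρ : 0 < E.ρ) (ha : ∀ l, 0 < E.a l)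
    (hη : 0 < W.η) (hα : 0 < W.α) (hv : ∀ k, 0 < W.vref k) {c κ₀ Υ : ℝ} (hc : 0 < c) (hκ₀ : 0 < κ₀)
    (hcκ : c ≤ κ₀) (hΥ : 0 < Υ) (h23 : W.DecreaseOnS c) (hK : W.PhaseErrorBound κ₀)
    (hY : E.AdmittanceBound Υ) (h35 : W.η < c / (E.ρ * Υ * (c + 5 * κ₀)))
    {γ : ℝ → DvocState N × LineState M} (hsol : E.IsSolutionOn W γ (Ici 0)) :
    Tendsto γ atTop (𝓝 0) ∨ ∃ T C : ℝ, 0 ≤ C ∧ ∀ s, T ≤ s →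
      infDist (γ s) (E.target W) ≤ C * Real.exp (-(E.lineDecayRate W c κ₀ Υ / 2) * (s - T)) := by
  rcases E.thm2_exists_tendsto_expTail W h hρ ha hη hα hv hc hκ₀ hcκ hΥ h23 hK hY h35 hsol with
    h0 | ⟨x, hx, -, T, C, hC, htail⟩
  · exact Or.inl h0
  · refine Or.inr ⟨T, C, hC, fun s hs => ?_⟩
    calc infDist (γ s) (E.target W) ≤ dist (γ s) x := infDist_le_dist_of_mem hx
      _ = ‖x - γ s‖ := by rw [dist_eq_norm, norm_sub_rev]
      _ ≤ C * Real.exp (-(E.lineDecayRate W c κ₀ Υ / 2) * (s - T)) := htail s hs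

end DvocLines

namespace DvocReduced

variable {N : ℕ} (W : DvocReduced N)

/-- **Reduced model (17): explicit exponential rate for the distance to `𝒮 ∩ 𝒜`, from the data
alone**: every solution on `[0, ∞)` tends to `0`, or `dist(v(s), 𝒮 ∩ 𝒜) ≤ C e^{−(α₁m/2)(s−T)}` for
all `s ≥ T`, some `T`, `C ≥ 0` (`m = decayMod`). [cite: GrossEtAl2019, Prop. 3 / Thm. 2; §V-B
(«exponential phase stability of the reduced-order system (17)»)] MODELLED: reduced model (17). -/
theorem infDist_expDecay [NeZero N] (hη : 0 < W.η) (hα : 0 < W.α) (hv : ∀ k, 0 < W.vref k)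
    {c κ₀ : ℝ} (hc : 0 < c) (hκ₀ : 0 < κ₀) (h23 : W.DecreaseOnS c) (hK : W.PhaseErrorBound κ₀)
    {γ : ℝ → DvocState N} (hsol : W.IsSolutionOn γ (Ici 0)) :
    Tendsto γ atTop (𝓝 0) ∨ ∃ T C : ℝ, 0 ≤ C ∧ ∀ s, T ≤ s →
      infDist (γ s) W.target ≤ C * Real.exp (-(W.alpha1 c κ₀ * W.decayMod c κ₀ / 2) * (s - T)) := by
  rcases W.tendsto_zero_or_exists_tendsto_expTail hη hα hv hc hκ₀ h23 hK hsol with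
    h0 | ⟨v, hvT, -, T, C, hC, htail⟩
  · exact Or.inl h0
  · refine Or.inr ⟨T, C, hC, fun s hs => ?_⟩
    calc infDist (γ s) W.target ≤ dist (γ s) v := infDist_le_dist_of_mem hvT
      _ = ‖v - γ s‖ := by rw [dist_eq_norm, norm_sub_rev]
      _ ≤ C * Real.exp (-(W.alpha1 c κ₀ * W.decayMod c κ₀ / 2) * (s - T)) := htail s hs

end DvocReduced

end Literature.MathematicalPhysics.PowerSystems
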